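import Summits.BirchSwinnertonDyer.BirchSwinnertonDyer.Theorems.AlignedTransportAtTwoMainConjectureTransportAlignedAtTwoSharedCubicTorsionUnique
import Summits.BirchSwinnertonDyer.BirchSwinnertonDyer.Theorems.AlignedTransportAtTwoMainConjectureTransportAlignedAtTwoRhombicOfNegDisc
import HarnessLib

/-!
# Crux C1 `MainConjectureTransportAlignedAtTwo` (stmt-BirchSwinnertonDyer-22296), line `birth`, plan «deltapos-galois» step (G1):
# THE GALOIS PLANE — two `Γ_ℚ`-equivariant non-zero maps `θᵢ : A → Wᵢ[2]` killing a common subgroup of index `≤ 4` differ by THE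
# equivariant isomorphism `W₁[2] ≃ W₂[2]` of the shared cubic field (lead att-p1 g10; `--supports 22296`)

THEOREMS ONLY (no `def`, no `sorry`, no named fact). Pure group theory on top of the tree's `2`-torsion Galois API. BSD is not proved by this;
C1 is not closed by this.

Context (`Cruxes/MainConjectureTransportAlignedAtTwo/Lines/birth-deltapos-galois-plan.md`, file (G1); memo `DELTA-POS-REAL-LOCUS-att-p1-g10.md` §3, §7).
In the `Δ > 0` residual the mod-`2` plus functionals of the two curves are `n̄ᵢ = e₂(Tᵢ*, θᵢ ·)` (file (K2), p664803) for the maps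
`θᵢ : A = J₀(N)[2] → Wᵢ[2]` induced by the modular parametrisations on the `2`-torsion of the Jacobian; these are `Γ_ℚ`-EQUIVARIANT for the
`ℚ`-structure of `J₀(N)` (carrier `ModularJacobianGaloisData`, `jacobiMap_galAct`), kill `𝔪·J₀(N)[2]` (Hecke eigen-ideal), a subgroup with at most
FOUR cosets (Buzzard's multiplicity one + Hecke self-duality: `…BuzzardKFour.fourCosets_of_dvd_S3`), and are non-zero (the `μ = 0` theorem). This file
is the abstract selection step, with the Galois action on `A` an arbitrary map `act : Γ_ℚ → A → A`:
* §1 `eq_bot_or_eq_top_of_forall_smul_mem` — a `Γ_ℚ`-stable subgroup of `W[2]` is `⊥` or `⊤` when `W` has no rational `2`-torsion abscissa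
  (Lagrange in the group of order `4` + the tree's `eq_zero_of_fixed_of_two_smul_eq_zero_of_ratTwoTorsionCard_eq_one`);
  `surjective_of_equivariant_of_exists_ne_zero` — an equivariant non-zero additive map into `W[2]` is onto.
* §2 **`ker_eq_of_equivariant_of_index_le_four`** — such a map has kernel EQUAL to any subgroup `K ⊆ ker` with `0 < [A : K] ≤ 4`;
  **`exists_equivariant_addEquiv_comp_eq`** — two such maps `θ₁, θ₂` (same `A`, same `K`) satisfy `θ₂ = e ∘ θ₁` for an equivariant
  `e : W₁[2] ≃+ W₂[2]`; **`comp_eq_of_sharedCubicField`** — hence for THE equivariant isomorphism of a shared cubic field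
  (`…SharedCubicTorsionUnique.existsUnique_equivariant_addEquiv_of_sharedCubicField`): every equivariant `e'` with `θ₂ = e' ∘ θ₁` is that one.
* §3 **`equivariant_addEquiv_T_eq`** — THE equivariant isomorphism sends, for every embedding `σ : F → ℚ̄`, the point of `W₁[2]` with abscissa `σ(r₁)/4` to
  the point of `W₂[2]` with abscissa `σ(r₂)/4` (the algebraic half of (G2): `AlignedAtInfinity` speaks about `σ(r₁)`, `σ(r₂)` under real embeddings).
What remains for (R1) after this file: the instantiation `A = J₀(N)[2]` (carrier + typing T1/T2), and the archimedean half of (G2) (choose `σ` with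
`ι(σ r₁)` the least real root; `AlignedAtInfinity`; `…HalfPeriodOrdering`).

References: Silverman AEC III.§7 [SilvermanAEC2009]; Darmon–Diamond–Taylor 1995 §1.7 [DarmonDiamondTaylor1995]; Buzzard 2000 Prop. 2.4
[Buzzard2000LevelLoweringModTwo].
-/

noncomputable section

-- justification: the `Summit.BirchSwinnertonDyer.BirchSwinnertonDyer.…` path repeats a component (route-file convention)
set_option linter.dupNamespace false
set_option autoImplicit false

open scoped Classical
open WeierstrassCurve Module
open Literature.NumberTheory.EllipticCurves Literature.NumberTheory.EllipticCurves.Greenberg1999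
open Summit.BirchSwinnertonDyer.Rank1Residual.F1Sign2
open Summit.BirchSwinnertonDyer.BirchSwinnertonDyer.Theorems.ThetaLayerLambdaCongruenceAtTwo
open Summit.BirchSwinnertonDyer.BirchSwinnertonDyer.Theorems.AlignedTransportAtTwoRhombicOfNegDisc hiding natCard_geomTorsion_two
open Summit.BirchSwinnertonDyer.BirchSwinnertonDyer.Theorems.AlignedTransportAtTwoSharedCubicTorsionUnique

namespace Summit.BirchSwinnertonDyer.BirchSwinnertonDyer.Theorems.AlignedTransportAtTwoDeltaPosGaloisPlane

/-! ## §1 Stable subgroups of `W[2]` and equivariant maps into it -/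

section OneCurve

variable (W : WeierstrassCurve ℚ) [W.IsElliptic]

/-- **A `Γ_ℚ`-stable subgroup of `E[2]` is trivial or everything** when `E` has no rational `2`-torsion abscissa: by Lagrange its order is `1`, `2`
or `4`; order `2` would make its non-zero element `Γ_ℚ`-fixed, i.e. a rational `2`-torsion point. [cite: SilvermanAEC2009, III.§7] -/
theorem eq_bot_or_eq_top_of_forall_smul_mem (ht : ∀ x : ℚ, ¬ HasRationalTwoTorsionX W x)
    (H : AddSubgroup (geomTorsion W (2 : ℤ)))
    (hH : ∀ (σ : Field.absoluteGaloisGroup ℚ) (P : geomTorsion W (2 : ℤ)), P ∈ H → σ • P ∈ H) : H = ⊥ ∨ H = ⊤ := by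
  have h1 : ratTwoTorsionCard W = 1 := ratTwoTorsionCard_eq_one_of_forall_not_hasRationalTwoTorsionX W ht
  have hG4 : Nat.card (geomTorsion W (2 : ℤ)) = 4 := WeierstrassCurve.natCard_geomTorsion_two W
  haveI : Finite (geomTorsion W (2 : ℤ)) := Nat.finite_of_card_ne_zero (by rw [hG4]; norm_num)
  have hdvd : Nat.card H ∣ 2 ^ 2 := by
    have := AddSubgroup.card_addSubgroup_dvd_card H
    rwa [hG4] at this
  obtain ⟨k, hk, hk'⟩ := (Nat.dvd_prime_pow Nat.prime_two).mp hdvd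
  interval_cases k
  · exact Or.inl (AddSubgroup.eq_bot_of_card_eq H (by simpa using hk'))
  · -- order `2`: the non-zero element is `Γ_ℚ`-fixed
    exfalso
    have hH2 : Nat.card H = 2 := by simpa using hk'
    obtain ⟨x, hx0, huniq⟩ := (Nat.card_eq_two_iff' (0 : H)).mp hH2
    set Q : geomTorsion W (2 : ℤ) := (x : geomTorsion W (2 : ℤ)) with hQ
    have hQ0 : Q ≠ 0 := fun h ↦ hx0 (Subtype.ext h)
    have hfix : ∀ σ : Field.absoluteGaloisGroup ℚ, σ • Q = Q := by
      intro σ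
      have hσH : σ • Q ∈ H := hH σ Q x.2
      have hσ0 : σ • Q ≠ 0 := by rwa [Ne, smul_eq_zero_iff_eq]
      have e1 := huniq ⟨σ • Q, hσH⟩ fun h ↦ hσ0 (congrArg Subtype.val h)
      exact congrArg Subtype.val e1
    have hQ2 : (2 : ℤ) • (Q : geomPoints W) = 0 := (mem_geomTorsion_iff W 2 _).mp Q.2
    have hfix' : ∀ σ : Field.absoluteGaloisGroup ℚ, σ • (Q : geomPoints W) = (Q : geomPoints W) := fun σ ↦ by
      rw [← AddSubgroup.torsionBy.coe_smul, hfix σ]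
    exact hQ0 (Subtype.ext (eq_zero_of_fixed_of_two_smul_eq_zero_of_ratTwoTorsionCard_eq_one W h1 hQ2 hfix'))
  · exact Or.inr ((AddSubgroup.card_eq_iff_eq_top H).mp ((by simpa using hk' : Nat.card H = 4).trans hG4.symm))

variable {W}

/-- **An equivariant non-zero additive map into `E[2]` is onto** (its range is a non-trivial `Γ_ℚ`-stable subgroup). [cite: SilvermanAEC2009, III.§7] -/
theorem surjective_of_equivariant_of_exists_ne_zero (ht : ∀ x : ℚ, ¬ HasRationalTwoTorsionX W x)
    {A : Type*} [AddCommGroup A] (act : Field.absoluteGaloisGroup ℚ → A → A)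
    (θ : A →+ geomTorsion W (2 : ℤ)) (hθ : ∀ (σ : Field.absoluteGaloisGroup ℚ) (a : A), θ (act σ a) = σ • θ a)
    (h0 : ∃ a, θ a ≠ 0) : Function.Surjective θ := by
  have hstab : ∀ (σ : Field.absoluteGaloisGroup ℚ) (P : geomTorsion W (2 : ℤ)), P ∈ θ.range → σ • P ∈ θ.range := by
    rintro σ P ⟨a, rfl⟩
    exact ⟨act σ a, hθ σ a⟩
  rcases eq_bot_or_eq_top_of_forall_smul_mem W ht θ.range hstab with h | h
  · obtain ⟨a, ha⟩ := h0
    exact absurd ((AddSubgroup.eq_bot_iff_forall _).mp h (θ a) ⟨a, rfl⟩) ha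
  · exact AddMonoidHom.range_eq_top.mp h

/-! ## §2 Equal kernels and the factorisation through the equivariant isomorphism -/

/-- **The kernel of an equivariant non-zero map into `E[2]` is pinned by a four-coset bound**: if `K ≤ ker θ` has `0 < [A : K] ≤ 4` then
`ker θ = K` (`[A : ker θ] = #E[2] = 4` divides `[A : K]`). [cite: Buzzard2000LevelLoweringModTwo, Prop. 2.4] -/
theorem ker_eq_of_equivariant_of_index_le_four (ht : ∀ x : ℚ, ¬ HasRationalTwoTorsionX W x)
    {A : Type*} [AddCommGroup A] (act : Field.absoluteGaloisGroup ℚ → A → A)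
    (θ : A →+ geomTorsion W (2 : ℤ)) (hθ : ∀ (σ : Field.absoluteGaloisGroup ℚ) (a : A), θ (act σ a) = σ • θ a)
    (h0 : ∃ a, θ a ≠ 0) (K : AddSubgroup A) (hK : K ≤ θ.ker) (hK0 : K.index ≠ 0) (hK4 : K.index ≤ 4) : θ.ker = K := by
  have hsurj := surjective_of_equivariant_of_exists_ne_zero ht act θ hθ h0
  have hker : θ.ker.index = 4 := by
    rw [AddSubgroup.index_ker, AddMonoidHom.range_eq_top.mpr hsurj, AddSubgroup.card_top]
    exact WeierstrassCurve.natCard_geomTorsion_two W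
  have hdvd : θ.ker.index ∣ K.index := AddSubgroup.index_dvd_of_le hK
  rw [hker] at hdvd
  have hK4' : K.index = 4 := by
    obtain ⟨c, hc⟩ := hdvd
    rcases Nat.eq_zero_or_pos c with rfl | hc0
    · simp at hc; exact absurd hc hK0
    · nlinarith
  -- `K ≤ ker θ` with equal finite index
  have hrel := AddSubgroup.relIndex_mul_index hK
  rw [hker, hK4'] at hrel
  have h1 : K.relIndex θ.ker = 1 := by omega
  exact le_antisymm (AddSubgroup.relIndex_eq_one.mp h1) hK

end OneCurve

section TwoCurves

variable {W₁ W₂ : WeierstrassCurve ℚ} [W₁.IsElliptic] [W₂.IsElliptic]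

/-- **Factorisation through an equivariant isomorphism.** Two `Γ_ℚ`-equivariant additive maps `θᵢ : A → Wᵢ[2]`, both non-zero, both killing a
subgroup `K ≤ A` with `0 < [A : K] ≤ 4` (both curves without rational `2`-torsion abscissa): there is a `Γ_ℚ`-equivariant `e : W₁[2] ≃+ W₂[2]` with
`θ₂ = e ∘ θ₁`. [cite: DarmonDiamondTaylor1995, §1.7] [cite: Buzzard2000LevelLoweringModTwo, Prop. 2.4] -/
theorem exists_equivariant_addEquiv_comp_eq
    (ht₁ : ∀ x : ℚ, ¬ HasRationalTwoTorsionX W₁ x) (ht₂ : ∀ x : ℚ, ¬ HasRationalTwoTorsionX W₂ x)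
    {A : Type*} [AddCommGroup A] (act : Field.absoluteGaloisGroup ℚ → A → A)
    (θ₁ : A →+ geomTorsion W₁ (2 : ℤ)) (θ₂ : A →+ geomTorsion W₂ (2 : ℤ))
    (hθ₁ : ∀ (σ : Field.absoluteGaloisGroup ℚ) (a : A), θ₁ (act σ a) = σ • θ₁ a)
    (hθ₂ : ∀ (σ : Field.absoluteGaloisGroup ℚ) (a : A), θ₂ (act σ a) = σ • θ₂ a)
    (h0₁ : ∃ a, θ₁ a ≠ 0) (h0₂ : ∃ a, θ₂ a ≠ 0)
    (K : AddSubgroup A) (hK₁ : K ≤ θ₁.ker) (hK₂ : K ≤ θ₂.ker) (hK0 : K.index ≠ 0) (hK4 : K.index ≤ 4) :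
    ∃ e : geomTorsion W₁ (2 : ℤ) ≃+ geomTorsion W₂ (2 : ℤ),
      (∀ (σ : Field.absoluteGaloisGroup ℚ) (P : geomTorsion W₁ (2 : ℤ)), e (σ • P) = σ • e P) ∧ ∀ a : A, θ₂ a = e (θ₁ a) := by
  have hsurj₁ := surjective_of_equivariant_of_exists_ne_zero ht₁ act θ₁ hθ₁ h0₁
  have hsurj₂ := surjective_of_equivariant_of_exists_ne_zero ht₂ act θ₂ hθ₂ h0₂
  have hk₁ : θ₁.ker = K := ker_eq_of_equivariant_of_index_le_four ht₁ act θ₁ hθ₁ h0₁ K hK₁ hK0 hK4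
  have hk₂ : θ₂.ker = K := ker_eq_of_equivariant_of_index_le_four ht₂ act θ₂ hθ₂ h0₂ K hK₂ hK0 hK4
  have hkk : θ₁.ker = θ₂.ker := hk₁.trans hk₂.symm
  -- `e = ē₂ ∘ (A/ker θ₁ = A/ker θ₂) ∘ ē₁⁻¹`
  let e₁ : A ⧸ θ₁.ker ≃+ geomTorsion W₁ (2 : ℤ) := QuotientAddGroup.quotientKerEquivOfSurjective θ₁ hsurj₁
  let e₂ : A ⧸ θ₂.ker ≃+ geomTorsion W₂ (2 : ℤ) := QuotientAddGroup.quotientKerEquivOfSurjective θ₂ hsurj₂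
  let j : A ⧸ θ₁.ker ≃+ A ⧸ θ₂.ker := QuotientAddGroup.quotientAddEquivOfEq hkk
  let e : geomTorsion W₁ (2 : ℤ) ≃+ geomTorsion W₂ (2 : ℤ) := e₁.symm.trans (j.trans e₂)
  have he₁ : ∀ a : A, e₁ (QuotientAddGroup.mk a) = θ₁ a := fun a ↦ rfl
  have he₂ : ∀ a : A, e₂ (QuotientAddGroup.mk a) = θ₂ a := fun a ↦ rfl
  have hj : ∀ a : A, j (QuotientAddGroup.mk a) = QuotientAddGroup.mk a := fun a ↦ rfl
  have hcomp : ∀ a : A, θ₂ a = e (θ₁ a) := by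
    intro a
    change θ₂ a = e₂ (j (e₁.symm (θ₁ a)))
    have : e₁.symm (θ₁ a) = QuotientAddGroup.mk a := by
      rw [AddEquiv.symm_apply_eq, he₁]
    rw [this, hj, he₂]
  refine ⟨e, fun σ P ↦ ?_, hcomp⟩
  obtain ⟨a, rfl⟩ := hsurj₁ P
  rw [← hθ₁, ← hcomp, ← hcomp, hθ₂]

/-- **…and that isomorphism is THE one of the shared cubic field.** Under the crux binder (cubic `F`, roots `e₁ e₂` of the two `u`-cubics, no rational
`2`-torsion abscissa, `Δ(W₂) ∉ ℚ²`), any equivariant `e'` with `θ₂ = e' ∘ θ₁` as above coincides with the unique `Γ_ℚ`-equivariant isomorphism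
`W₁[2] ≃+ W₂[2]` (`…SharedCubicTorsionUnique.equivariant_addEquiv_unique`). So `θ₂ = e ∘ θ₁` for every / the equivariant `e`.
[cite: DarmonDiamondTaylor1995, §1.7] -/
theorem comp_eq_of_sharedCubicField
    {F : Type*} [Field F] [Algebra ℚ F] [FiniteDimensional ℚ F] (hF : finrank ℚ F = 3)
    (ht₁ : ∀ x : ℚ, ¬ HasRationalTwoTorsionX W₁ x) (ht₂ : ∀ x : ℚ, ¬ HasRationalTwoTorsionX W₂ x) (hΔ₂ : ¬ IsSquare W₂.Δ)
    {r₁ r₂ : F} (hr₁ : Polynomial.aeval r₁ (twoDivisionUCubic W₁) = 0) (hr₂ : Polynomial.aeval r₂ (twoDivisionUCubic W₂) = 0)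
    {A : Type*} [AddCommGroup A] (act : Field.absoluteGaloisGroup ℚ → A → A)
    (θ₁ : A →+ geomTorsion W₁ (2 : ℤ)) (θ₂ : A →+ geomTorsion W₂ (2 : ℤ))
    (hθ₁ : ∀ (σ : Field.absoluteGaloisGroup ℚ) (a : A), θ₁ (act σ a) = σ • θ₁ a)
    (hθ₂ : ∀ (σ : Field.absoluteGaloisGroup ℚ) (a : A), θ₂ (act σ a) = σ • θ₂ a)
    (h0₁ : ∃ a, θ₁ a ≠ 0) (h0₂ : ∃ a, θ₂ a ≠ 0)
    (K : AddSubgroup A) (hK₁ : K ≤ θ₁.ker) (hK₂ : K ≤ θ₂.ker) (hK0 : K.index ≠ 0) (hK4 : K.index ≤ 4)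
    (e : geomTorsion W₁ (2 : ℤ) ≃+ geomTorsion W₂ (2 : ℤ))
    (he : ∀ (σ : Field.absoluteGaloisGroup ℚ) (P : geomTorsion W₁ (2 : ℤ)), e (σ • P) = σ • e P) :
    ∀ a : A, θ₂ a = e (θ₁ a) := by
  obtain ⟨e', he', hcomp⟩ := exists_equivariant_addEquiv_comp_eq ht₁ ht₂ act θ₁ θ₂ hθ₁ hθ₂ h0₁ h0₂ K hK₁ hK₂ hK0 hK4
  obtain ⟨e₀, -, huniq⟩ := existsUnique_equivariant_addEquiv_of_sharedCubicField W₁ W₂ hF ht₁ ht₂ hΔ₂ hr₁ hr₂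
  have h1 : e' = e₀ := huniq e' he'
  have h2 : e = e₀ := huniq e he
  intro a
  rw [hcomp a, h1, ← h2]

end TwoCurves

/-! ## §3 The equivariant isomorphism on LETTERS: the point over `σ(r₁)/4` goes to the point over `σ(r₂)/4` -/

section Letters

open Polynomial
open Literature.NumberTheory.EllipticCurves.DokchitserDokchitser2012
open Summit.BirchSwinnertonDyer.BirchSwinnertonDyer.Theorems.AlignedTransportAtTwoSharedCubicTorsion

variable (W₁ W₂ : WeierstrassCurve ℚ) [W₁.IsElliptic] [W₂.IsElliptic]
  {F : Type*} [Field F] [Algebra ℚ F] [FiniteDimensional ℚ F]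

/-- **THE equivariant isomorphism matches the letters of each embedding.** Under the crux binder (cubic `F`, roots `r₁, r₂ ∈ F` of the two
`u`-cubics, no rational `2`-torsion abscissa, `Δ(W₂) ∉ ℚ²`), the (unique) `Γ_ℚ`-equivariant `e : W₁[2] ≃+ W₂[2]` sends, for EVERY embedding
`σ : F → ℚ̄`, the `2`-torsion point of `W₁` with abscissa `σ(r₁)/4` to the `2`-torsion point of `W₂` with abscissa `σ(r₂)/4` (the construction
of `…SharedCubicTorsion.exists_equivariant_addEquiv_of_sharedCubicField`, made explicit, plus uniqueness). This is the algebraic half of reading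
`AlignedAtInfinity` (a statement about `σ(r₁)`, `σ(r₂)` under REAL embeddings) on `2`-torsion points. [cite: SilvermanAEC2009, III.§7]
[cite: DarmonDiamondTaylor1995, Prop. 2.11 (a)] -/
theorem equivariant_addEquiv_T_eq (hF : finrank ℚ F = 3)
    (ht₁ : ∀ x : ℚ, ¬ HasRationalTwoTorsionX W₁ x) (ht₂ : ∀ x : ℚ, ¬ HasRationalTwoTorsionX W₂ x) (hΔ₂ : ¬ IsSquare W₂.Δ)
    {r₁ r₂ : F} (hr₁ : aeval r₁ (twoDivisionUCubic W₁) = 0) (hr₂ : aeval r₂ (twoDivisionUCubic W₂) = 0)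
    (e : geomTorsion W₁ (2 : ℤ) ≃+ geomTorsion W₂ (2 : ℤ))
    (he : ∀ (g : Field.absoluteGaloisGroup ℚ) (P : geomTorsion W₁ (2 : ℤ)), e (g • P) = g • e P)
    (σ : F →ₐ[ℚ] AlgebraicClosure ℚ) {i₁ i₂ : Fin 3}
    (hi₁ : xT W₁ two_ne_zero i₁ = σ r₁ / 4) (hi₂ : xT W₂ two_ne_zero i₂ = σ r₂ / 4) :
    e (T W₁ two_ne_zero i₁) = T W₂ two_ne_zero i₂ := by
  -- the explicit construction (as in `…SharedCubicTorsion`): index maps, the permutation `π = j₂ ∘ j₁⁻¹`, the letter isomorphism `φ`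
  obtain ⟨j₁, hj₁⟩ := exists_index_fun W₁ hr₁
  obtain ⟨j₂, hj₂⟩ := exists_index_fun W₂ hr₂
  set ρ₁ : (F →ₐ[ℚ] AlgebraicClosure ℚ) ≃ Fin 3 := Equiv.ofBijective j₁ (bijective_index W₁ hF ht₁ hr₁ hj₁) with hρ₁
  set π : Equiv.Perm (Fin 3) := ρ₁.symm.trans (Equiv.ofBijective j₂ (bijective_index W₂ hF ht₂ hr₂ hj₂)) with hπ
  have hπ₁ : ∀ τ, π (j₁ τ) = j₂ τ := fun τ ↦ by
    rw [hπ, Equiv.trans_apply]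
    have : ρ₁.symm (j₁ τ) = τ := by
      apply ρ₁.injective; rw [Equiv.apply_symm_apply]; rfl
    rw [this]; rfl
  have hcomm : ∀ (g : Field.absoluteGaloisGroup ℚ) (i : Fin 3),
      π (permGal W₁ two_ne_zero g i) = permGal W₂ two_ne_zero g (π i) := by
    intro g i
    obtain ⟨τ, rfl⟩ := (bijective_index W₁ hF ht₁ hr₁ hj₁).2 i
    rw [permGal_index W₁ hj₁, hπ₁, hπ₁, permGal_index W₂ hj₂]
  obtain ⟨φ, hφ⟩ := exists_addEquiv_T_eq W₁ W₂ π
  have hφeq : ∀ (g : Field.absoluteGaloisGroup ℚ) (P : geomTorsion W₁ (2 : ℤ)), φ (g • P) = g • φ P := by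
    intro g P
    rcases eq_zero_or_eq_T W₁ two_ne_zero P with rfl | ⟨i, rfl⟩
    · rw [smul_zero, map_zero, smul_zero]
    · rw [← T_permGal, hφ, hφ, hcomm, T_permGal]
  -- uniqueness: `e = φ`; and the letters: `i₁ = j₁ σ`, `i₂ = j₂ σ`
  have heφ : e = φ := equivariant_addEquiv_unique W₁ W₂ ht₂ hΔ₂ e φ he hφeq
  have hi₁' : i₁ = j₁ σ := xT_injective W₁ two_ne_zero (by rw [hi₁, hj₁])
  have hi₂' : i₂ = j₂ σ := xT_injective W₂ two_ne_zero (by rw [hi₂, hj₂])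
  rw [heφ, hi₁', hφ, hπ₁, hi₂']

omit [FiniteDimensional ℚ F] in
/-- **Letters exist**: every embedding `σ` has its letter `i` with `x(T_i) = σ(r)/4` (re-export of `…SharedCubicTorsion.exists_xT_eq` for the
consumer's convenience). [cite: SilvermanAEC2009, Ex. III.3.7 (d)] -/
theorem exists_letter {W : WeierstrassCurve ℚ} [W.IsElliptic] {r : F} (hr : aeval r (twoDivisionUCubic W) = 0)
    (σ : F →ₐ[ℚ] AlgebraicClosure ℚ) : ∃ i : Fin 3, xT W two_ne_zero i = σ r / 4 :=
  exists_xT_eq W hr σ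

end Letters

end Summit.BirchSwinnertonDyer.BirchSwinnertonDyer.Theorems.AlignedTransportAtTwoDeltaPosGaloisPlane

end
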